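import Literature.Computation.Certificates.SemidefiniteRigorousBoundsEnclosure
import Literature.Computation.Certificates.DyadicCholResidualWitness

/-!
# The LMI-form rigorous bound with Cholesky-residual-witnessed PSD multipliers (conic certificates in "dyadic-eig" mode)

Topic `Literature/Computation/Certificates`; companion of `FactoredCertificate.lean` (the Gram mode:
multipliers `Z_k = W_k W_kᵀ`, PSD by construction, `d_k = 0`). Here the PSD multipliers of a
lower-bound certificate in inequality (LMI / "y-") form are arbitrary real symmetric matrices `Z_k`
(in the file formats: dyadic, `Z_k = Zint_k / 2^K`) that are NOT positive semidefinite by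
construction; each comes with a CHOLESKY-RESIDUAL WITNESS — a factor `R_k`, a scale `t_k > 0`, a
denominator `d_k > 0`, a shift `σ_k` and a bound `r_k` on the row sums of the exact residual
`E_k = t_k²·d_k·Z_k − t_k σ_k·1 − R_kᴴ R_k` — which certifies `λ_min(Z_k) ≥ (t_k σ_k − r_k)/(t_k² d_k)`
(`DyadicCholResidualWitness.posSemidef_sub_smul_one`, S. M. Rump 1999 §4 / Alg. 4.1). Feeding this
eigenvalue bound as the defect `d_k` of Jansson–Chaykin–Keil's inequality-form bound
(`JanssonChaykinKeil.lmiForm_bound`, this directory) gives ONE soundness statement whose hypotheses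
are exactly the checks of a reader of such a certificate:

* `DyadicEigCertificate.bound` — for every feasible `y`:
  `β − Σ_{v≠u} |r_v| ρ_v − Σ_k |min(0, (t_k σ_k − r_k)/(t_k² d_k))| τ_k ≤ c·y + c₀`,
  with the exact residuals `r_v`, `β` of `lmiForm_bound`;
* `DyadicEigCertificate.bound_of_abs_le` — the same for a reader that only ENCLOSES the residuals
  (`|r_v| ≤ R_v`, `β_lo ≤ β`; `JanssonChaykinKeil.lmiForm_bound_of_abs_le`).

This is the certificate kind `certsdp-conic/1`, PSD block mode `dyadic-eig` with eigenvalue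
certificate `chol-residual-infnorm/1` (certsdp `RIGOR-LAYER.md` §1–§3): block fields
`Z_scaled_lower = Zint` (so `Z = Zint/2^K`), `eig.sigma_scaled = s`, `eig.R_scaled_lower = Rint`,
`‖E‖_∞·4^K = max row sum of |(Zint − s·1)·2^K − Rint Rintᵀ|`, `lower_bound = s/2^K − ‖E‖_∞`; in the
notation below `t = 2^K`, `d = 1`, `σ = s`, `R = Rintᵀ`, `r = 4^K ‖E‖_∞`, and indeed
`(tσ − r)/(t²d) = s/2^K − ‖E‖_∞`. A Gram-mode block `Z = F Fᵀ/4^K` is the special case `σ = 0`,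
`R = Fᵀ`, residual `0`, `r = 0`, defect `0` — so a certificate mixing both modes is covered.

Recorded as a COROLLARY (composition of the two cited results), not as a statement of either source:

* C. Jansson, D. Chaykin, C. Keil, SIAM J. Numer. Anal. 46 (2007/08) 180–200 [JanssonChaykinKeil2008],
  Lemma 3.1 and the mechanism of Thm 3.2 — through `JanssonChaykinKeil.lmiForm_bound`;
* S. M. Rump, *Verified solution of large linear and nonlinear systems* (1999) §4, eq. after (12) and
  Algorithm 4.1 step 7 [Rump1999VerifiedLargeSystems] — through
  `DyadicCholResidualWitness.posSemidef_sub_smul_one`.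

No definitions, no named facts, no instances; two short proofs.
-/

namespace Literature.Computation.Certificates

open Matrix Finset
open scoped BigOperators

namespace DyadicEigCertificate

variable {V : Type*} [Fintype V] [DecidableEq V] {E : Type*} [Fintype E] {I : Type*} [Fintype I]
variable {K : Type*} [Fintype K] {σ : K → Type*} [∀ k, Fintype (σ k)] [∀ k, DecidableEq (σ k)]
variable {π : K → Type*} [∀ k, Fintype (π k)]

/-- theorem (**rigorous lower bound in LMI form from a certificate whose PSD multipliers carry
Cholesky-residual witnesses** — conic/1 "dyadic-eig" mode). Data: objective `c·y + c₀` over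
`y ∈ ℝ^V`, unit variable `y_u = 1`, a-priori bounds `|y_v| ≤ ρ_v (v ≠ u)`, equality rows
`row_e·y = rhs_e`, inequality rows `row_i·y ≤ upper_i`, PSD blocks `M_k(y) = C_k + Σ_v y_v F_{k,v} ⪰ 0`
with trace bounds `tr M_k(y) ≤ τ_k`. Certificate: multipliers `λ_e` (free), `κ_i ≥ 0`, real SYMMETRIC
matrices `Z_k` (no sign condition), and for every block a witness `(R_k, d_k > 0, t_k > 0, σ_k, r_k)`
with `Σ_j ‖E_k i j‖ ≤ r_k` for every row `i` of the exact residual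
`E_k = t_k² d_k·Z_k − t_k σ_k·1 − R_kᴴ R_k` (`DyadicCholResidualWitness.residual`; for real entries
`‖·‖ = |·|`). With the exact residuals `r_v = c_v − Σ_e λ_e row_e[v] + Σ_i κ_i row_i[v] − Σ_k tr(Z_k F_{k,v})`
and `β = c₀ + r_u + Σ_e λ_e rhs_e − Σ_i κ_i upper_i − Σ_k tr(Z_k C_k)`, every feasible `y` satisfies
`β − Σ_{v≠u} |r_v| ρ_v − Σ_k |min(0, (t_k σ_k − r_k)/(t_k² d_k))| τ_k ≤ c·y + c₀`.
(Proof: the witness gives `Z_k − ((t_k σ_k − r_k)/(t_k² d_k))·1 ⪰ 0`; apply `lmiForm_bound` with this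
defect.) SOURCE: [cite: JanssonChaykinKeil2008, Lemma 3.1 and Thm 3.2 (inequality-form corollary)]
and [cite: Rump1999VerifiedLargeSystems, §4 eq. after (12) and Algorithm 4.1 step 7 (PDF p. 243)] —
a COROLLARY composing `JanssonChaykinKeil.lmiForm_bound` with
`DyadicCholResidualWitness.posSemidef_sub_smul_one`; DEVIATIONS from print: not a printed statement.
CERTIFICATE KIND: certsdp-conic/1, PSD mode `dyadic-eig`, eig certificate `chol-residual-infnorm/1`
(Gram-mode blocks are the case `σ_k = 0`, `R_k = F_kᵀ`, `r_k = 0`); FIELDS: `lam ↦ eq`, `κ ↦ ineq`,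
`Z k ↦ Z_scaled_lower/2^K`, `tt k ↦ 2^K`, `dd k ↦ 1`, `sg k ↦ eig.sigma_scaled`,
`Rw k ↦ (eig.R_scaled_lower)ᵀ`, `rr k ↦ 4^K·eig.E_inf_norm`, `ρ, τ ↦ problem a-priori / trace bounds`,
`r, β ↦ the reader's exact recomputation`.
NOT COVERED: the float solver and the float Cholesky (only the exact residual enters); the reader's
parsing and its integer arithmetic; unbounded variables (`ρ_v` finite for all `v ≠ u`; certsdp's
`absorb_unbounded` must have made their residuals vanish — not expressed here). -/
theorem bound (c : V → ℝ) (c0 : ℝ) (u : V)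
    (rowE : E → V → ℝ) (rhs : E → ℝ) (rowI : I → V → ℝ) (upper : I → ℝ)
    (Cb : ∀ k, Matrix (σ k) (σ k) ℝ) (F : ∀ k, V → Matrix (σ k) (σ k) ℝ)
    (ρ : V → ℝ) (τ : K → ℝ)
    -- a feasible point
    {y : V → ℝ} (hyu : y u = 1) (hρ : ∀ v, v ≠ u → |y v| ≤ ρ v)
    (heq : ∀ e, ∑ v, rowE e v * y v = rhs e) (hineq : ∀ i, ∑ v, rowI i v * y v ≤ upper i)
    (hpsd : ∀ k, (Cb k + ∑ v, y v • F k v).PosSemidef)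
    (hτ : ∀ k, trace (Cb k + ∑ v, y v • F k v) ≤ τ k)
    -- the certificate: multipliers and symmetric PSD-candidate blocks
    (lam : E → ℝ) (κ : I → ℝ) (hκ : ∀ i, 0 ≤ κ i) (Z : ∀ k, Matrix (σ k) (σ k) ℝ)
    (hZh : ∀ k, (Z k).IsHermitian)
    -- the Cholesky-residual witnesses of the blocks
    (Rw : ∀ k, Matrix (π k) (σ k) ℝ) (dd tt sg rr : K → ℝ) (hdd : ∀ k, 0 < dd k)
    (htt : ∀ k, 0 < tt k)
    (hrow : ∀ k i,
      ∑ j, ‖DyadicCholResidualWitness.residual (Z k) (Rw k) (dd k) (tt k) (sg k) i j‖ ≤ rr k)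
    -- the exact residuals
    (r : V → ℝ)
    (hr : ∀ v, r v = c v - ∑ e, lam e * rowE e v + ∑ i, κ i * rowI i v - ∑ k, trace (Z k * F k v))
    (β : ℝ)
    (hβ : β = c0 + r u + ∑ e, lam e * rhs e - ∑ i, κ i * upper i - ∑ k, trace (Z k * Cb k)) :
    β - ∑ v ∈ Finset.univ.erase u, |r v| * ρ v
      - ∑ k, |min 0 ((tt k * sg k - rr k) / (tt k ^ 2 * dd k))| * τ k ≤ ∑ v, c v * y v + c0 := by
  have hZ : ∀ k, (Z k - ((tt k * sg k - rr k) / (tt k ^ 2 * dd k)) •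
      (1 : Matrix (σ k) (σ k) ℝ)).PosSemidef := fun k => by
    simpa only [RCLike.ofReal_real_eq_id, id_eq] using
      DyadicCholResidualWitness.posSemidef_sub_smul_one (hZh k) (Rw k) (hdd k) (htt k) (hrow k)
  exact JanssonChaykinKeil.lmiForm_bound c c0 u rowE rhs rowI upper Cb F ρ τ hyu hρ heq hineq hpsd hτ
    lam κ hκ Z (fun k => (tt k * sg k - rr k) / (tt k ^ 2 * dd k)) hZ r hr β hβ

/-- theorem (the same certificate read by an ENCLOSING reader). As `bound`, but the reader knows the
exact residuals only through bounds `|r_v| ≤ R_v (v ≠ u)` and `β_lo ≤ β` (interval / directed-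
rounding evaluation; irrational or interval problem data): every feasible `y` satisfies
`β_lo − Σ_{v≠u} R_v ρ_v − Σ_k |min(0, (t_k σ_k − r_k)/(t_k² d_k))| τ_k ≤ c·y + c₀`.
SOURCE: [cite: JanssonChaykinKeil2008, Lemma 3.1 and Thm 3.2 (inequality-form corollary)],
[cite: Rump1999VerifiedLargeSystems, §4 eq. after (12) and Algorithm 4.1 step 7 (PDF p. 243)],
[cite: Jansson2007, remark after (4.3), p. 9] — a COROLLARY composing
`JanssonChaykinKeil.lmiForm_bound_of_abs_le` with `DyadicCholResidualWitness.posSemidef_sub_smul_one`;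
DEVIATIONS from print: not a printed statement. CERTIFICATE KIND: certsdp-conic/1 `dyadic-eig` read
by an interval reader; FIELDS: as in `bound`, `R ↦ sup |residual enclosure|`, `βlo ↦ inf of the β
enclosure`. NOT COVERED: the interval arithmetic producing `R`, `β_lo`; as in `bound`. -/
theorem bound_of_abs_le (c : V → ℝ) (c0 : ℝ) (u : V)
    (rowE : E → V → ℝ) (rhs : E → ℝ) (rowI : I → V → ℝ) (upper : I → ℝ)
    (Cb : ∀ k, Matrix (σ k) (σ k) ℝ) (F : ∀ k, V → Matrix (σ k) (σ k) ℝ)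
    (ρ : V → ℝ) (τ : K → ℝ)
    -- a feasible point
    {y : V → ℝ} (hyu : y u = 1) (hρ : ∀ v, v ≠ u → |y v| ≤ ρ v)
    (heq : ∀ e, ∑ v, rowE e v * y v = rhs e) (hineq : ∀ i, ∑ v, rowI i v * y v ≤ upper i)
    (hpsd : ∀ k, (Cb k + ∑ v, y v • F k v).PosSemidef)
    (hτ : ∀ k, trace (Cb k + ∑ v, y v • F k v) ≤ τ k)
    -- the certificate: multipliers and symmetric PSD-candidate blocks with witnesses
    (lam : E → ℝ) (κ : I → ℝ) (hκ : ∀ i, 0 ≤ κ i) (Z : ∀ k, Matrix (σ k) (σ k) ℝ)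
    (hZh : ∀ k, (Z k).IsHermitian)
    (Rw : ∀ k, Matrix (π k) (σ k) ℝ) (dd tt sg rr : K → ℝ) (hdd : ∀ k, 0 < dd k)
    (htt : ∀ k, 0 < tt k)
    (hrow : ∀ k i,
      ∑ j, ‖DyadicCholResidualWitness.residual (Z k) (Rw k) (dd k) (tt k) (sg k) i j‖ ≤ rr k)
    -- enclosures of the residuals
    (R : V → ℝ)
    (hR : ∀ v, v ≠ u →
      |c v - ∑ e, lam e * rowE e v + ∑ i, κ i * rowI i v - ∑ k, trace (Z k * F k v)| ≤ R v)
    (βlo : ℝ)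
    (hβ : βlo ≤ c0 + (c u - ∑ e, lam e * rowE e u + ∑ i, κ i * rowI i u - ∑ k, trace (Z k * F k u))
      + ∑ e, lam e * rhs e - ∑ i, κ i * upper i - ∑ k, trace (Z k * Cb k)) :
    βlo - ∑ v ∈ Finset.univ.erase u, R v * ρ v
      - ∑ k, |min 0 ((tt k * sg k - rr k) / (tt k ^ 2 * dd k))| * τ k ≤ ∑ v, c v * y v + c0 := by
  have hZ : ∀ k, (Z k - ((tt k * sg k - rr k) / (tt k ^ 2 * dd k)) •
      (1 : Matrix (σ k) (σ k) ℝ)).PosSemidef := fun k => by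
    simpa only [RCLike.ofReal_real_eq_id, id_eq] using
      DyadicCholResidualWitness.posSemidef_sub_smul_one (hZh k) (Rw k) (hdd k) (htt k) (hrow k)
  exact JanssonChaykinKeil.lmiForm_bound_of_abs_le c c0 u rowE rhs rowI upper Cb F ρ τ hyu hρ heq
    hineq hpsd hτ lam κ hκ Z (fun k => (tt k * sg k - rr k) / (tt k ^ 2 * dd k)) hZ R hR βlo hβ

end DyadicEigCertificate

end Literature.Computation.Certificates
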